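import Mathlib
import Summits.Ventures.HodgeRepro2.T6N5Skeleton
import Summits.Ventures.HodgeRepro2.T6N5LocalDatum
import Summits.Ventures.HodgeRepro2.T6N5LocalHyp

/-!
# T6N5Local — Tier 6, M2 sub-step N5 (t6-p8's half): the (b)-existence at the finite non-split places
(TIER5 §N5.11 Lemma N5.L3 and Theorem N5.T2) in kernel, and condition (b) of the N5 skeleton

* `signClass_nonempty` — LEMMA N5.L3 («both signs occur»): from the displayed Epsilon Dichotomy (Borade et al.
  Theorem 3.5) and the non-vanishing of the Weil representation of `U(V_s) × U(W)` restricted to the compact group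
  `U(V_s)` (some character `α` of `K¹` occurs — TIER5 (A1), an explicit binder), for each sign `s` there is a
  conjugate-symplectic `ξ = χ_W⁻¹·α_K` with `ε_v(ξ) = s`.
* `N5Local_main` — THEOREM N5.T2 (the coupled local system): conjugate-symplectic `ξ_a, ξ_b, ξ_c, ξ_d` with the sign
  equations `(b_A)_v`, `(b_B)_v` and `(S-H)_v ξ_c ξ_d = ξ_a ξ_b`; cases (i) (`v ∉ S_g`) and (ii) (`v ∈ S_g`,
  `s_a = −s_b`: the swap) are PROVED from Lemma N5.L3; case (iii) (`v ∈ S_g`, `s_a = s_b`: the forced opposite signs,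
  TIER5 N5.11.5 (iii-inert) / (iii-ramified) from Lemma N5.L4's conductor computations) is the explicit binder
  `hiii` [at this cut (gen 0) a residual of class IR; DISCHARGED DOWNSTREAM in this lane: at inert places by
  `N5LocalInert.hiii_of_inert` (TIER5 §N5.12.2 Lemma N5.L5 from GGP-ex Proposition 3.1 + Tate (3.2.2)–(3.2.3) +
  conductor arithmetic, module T6N5LocalInert) and at ramified places by `N5LocalRam.hiii_of_ramified` (Tate
  (3.2.6.3) + GGP Proposition 5.1 (2), module T6N5LocalRam), consumed by `N5LocalInertWeil.N5Local_main_inert_weil` /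
  `N5LocalRamWeil.N5Local_main_ram_weil` («both residuals discharged») and by
  `N5LocalSmooth.N5Local_main_inert_weil_smooth` / `N5LocalSmooth.N5Local_main_ram_weil_smooth`, on which the
  per-place statements of record v2 (module T6N5LocalWeilQuotientSmooth) rest; no display of the lane cites Biswas
  2021's formula (2.2) — Biswas §2 is cited for the filtration / conductor conventions only; the μ-twist comes from
  Tate's (3.2.6.3)].
* `condB_sides` — the two sides of TIER5 §N5.5 built from the local choices (`omega := ω_{E_v/F_v}(λ_i)`,
  `eps := ε_v(ξ_i)`) satisfy t6-p7's `ToricSide.condB` (T6N5Skeleton) at every place of the index type.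
Filing record: v1 = p402767 (gen 0, 2026-08-25; the banded bytes of record, commit as rowed by the lead); this v2 is
docstring-only — the two bracketed residual clauses (here and on `N5Local_main`) updated to the lane's state under the
PARK release clause (t6-lead STATUS l. 13037 (1)), every declaration byte-identical to v1.
README §8(d): uses an L-value-free non-vanishing device: NO.
-/

namespace Summit.Ventures.HodgeRepro2.T6.N5Local

open Summit.Ventures.HodgeRepro2.T6.N5LocalDatum Summit.Ventures.HodgeRepro2.T6.N5Skeleton
  Summit.Ventures.HodgeRepro2.T6.Hyp

variable (D : LocalSignDatum)

/-- `χ_W⁻¹ · α_K` is conjugate-symplectic when `χ_W` is and `α_K` is conjugate-orthogonal (TIER5 (A2): the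
restriction to `F_v^×` is `η_v⁻¹ · 1 = η_v`, `η_v` being quadratic). -/
theorem isCS_inv_χW_mul (hη : D.η * D.η = 1) (hχW : D.IsCS D.χW) {α : D.Char} (hα : D.IsCO α) :
    D.IsCS (D.χW⁻¹ * α) := by
  unfold LocalSignDatum.IsCS at *
  unfold LocalSignDatum.IsCO at hα
  rw [map_mul, map_inv, hχW, hα, mul_one]
  exact (eq_inv_of_mul_eq_one_left hη).symm

/-- LEMMA N5.L3 (TIER5 §N5.11.3), «both signs occur»: for each `s ∈ {±1}` the sign class `C_s(v)` is non-empty —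
from the displayed Theorem 3.5 and (A1) (some `α` occurs in the Weil representation for the line `V_s`). -/
theorem signClass_nonempty (h35 : BFGYYZ2025_Thm3_5 D)
    (hA1 : ∀ s : ℤˣ, ∃ α : D.Char, D.IsCO α ∧ D.Theta s α)
    (hW : D.epsdW = 1) (hη : D.η * D.η = 1) (hχW : D.IsCS D.χW) (s : ℤˣ) :
    ∃ ξ : D.Char, ξ ∈ D.signClass s := by
  obtain ⟨α, hα, hθ⟩ := hA1 s
  refine ⟨D.χW⁻¹ * α, isCS_inv_χW_mul D hη hχW hα, ?_⟩
  have := (h35 s α hα).mp hθ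
  rwa [hW, mul_one] at this

/-- The conclusion of THEOREM N5.T2 at the place: four conjugate-symplectic characters
`(ξ_a, ξ_b, ξ_c, ξ_d) = (ξ 0, ξ 1, ξ 2, ξ 3)` with `(b_A)_v`: `ε_v(ξ_a) = s_a`, `ε_v(ξ_b) = s_b`;
`(b_B)_v`: `ε_v(ξ_c) = η_v(u)·s_a`, `ε_v(ξ_d) = η_v(u)·s_b`; `(S-H)_v`: `ξ_c ξ_d = ξ_a ξ_b`
(TIER5 §N5.11.5; `s_i = ω_{E_v/F_v}(λ_i)`). -/
def LocalSolution (ξ : Fin 4 → D.Char) : Prop :=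
  (∀ i, D.IsCS (ξ i)) ∧
  D.eps (ξ 0) = D.ηLine 0 ∧ D.eps (ξ 1) = D.ηLine 1 ∧
  D.eps (ξ 2) = D.ηu * D.ηLine 0 ∧ D.eps (ξ 3) = D.ηu * D.ηLine 1 ∧
  ξ 2 * ξ 3 = ξ 0 * ξ 1

/-- The pair form of case (iii) (TIER5 N5.11.5 (iii-inert) and (iii-ramified) both have this shape): from a
conjugate-symplectic `a` with `ε_v(a) = s` and a conjugate-symplectic `c` with `ε_v(c) = −s` and
`ε_v(c⁻¹·a²) = −s`, the quadruple `(a, a, c, c⁻¹·a²)` solves the coupled system with `s_a = s_b = s` and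
`η_v(u) = −1` — (iii-inert) with `(a, c) = (μ, ξ₁)` or `(μλ̃, ξ₂)`, (iii-ramified) with `(a, c) = (χ_s, χ_s μ)`. -/
theorem localSolution_of_pair (hu : D.ηu = -1) (h01 : D.ηLine 0 = D.ηLine 1) {a c : D.Char}
    (ha : D.IsCS a) (hc : D.IsCS c) (has : D.eps a = D.ηLine 0) (hcs : D.eps c = -D.ηLine 0)
    (hc' : D.eps (c⁻¹ * a * a) = -D.ηLine 0) :
    ∃ ξ : Fin 4 → D.Char, LocalSolution D ξ := by
  have hCS : D.IsCS (c⁻¹ * a * a) := by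
    unfold LocalSignDatum.IsCS at *
    rw [map_mul, map_mul, map_inv, hc, ha, inv_mul_cancel, one_mul]
  refine ⟨![a, a, c, c⁻¹ * a * a], ?_, has, h01 ▸ has, ?_, ?_, ?_⟩
  · intro i
    fin_cases i <;> simp [ha, hc, hCS]
  · simp only [Matrix.cons_val]
    rw [hcs, hu, neg_one_mul]
  · simp only [Matrix.cons_val]
    rw [hc', hu, h01, neg_one_mul]
  · simp only [Matrix.cons_val]
    rw [← mul_assoc, mul_inv_cancel_left]

/-- THEOREM N5.T2 (TIER5 §N5.11.5): the coupled local system is solvable at the finite non-split place `v`.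
Cases (i) `v ∉ S_g` (`η_v(u) = 1`: take `(ξ_c, ξ_d) := (ξ_a, ξ_b)`) and (ii) `v ∈ S_g`, `s_a = −s_b`
(the swap `(ξ_c, ξ_d) := (ξ_b, ξ_a)`) are proved from Lemma N5.L3; case (iii) `v ∈ S_g`, `s_a = s_b =: s`
is reduced by `localSolution_of_pair` to the binder `hiii` = «C_s(v) has an element `a` and C_{−s}(v) an element
`c` with `c⁻¹·a² ∈ C_{−s}(v)`» [at this cut (gen 0) a residual of class IR — TIER5 N5.11.5 (iii-inert) /
(iii-ramified); DISCHARGED DOWNSTREAM by `N5LocalInert.hiii_of_inert` and `N5LocalRam.hiii_of_ramified` (see the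
module docstring), so that `N5LocalInertWeil.N5Local_main_inert_weil` / `N5LocalRamWeil.N5Local_main_ram_weil` carry
no such binder]. -/
theorem N5Local_main (h35 : BFGYYZ2025_Thm3_5 D)
    (hA1 : ∀ s : ℤˣ, ∃ α : D.Char, D.IsCO α ∧ D.Theta s α)
    (hW : D.epsdW = 1) (hη : D.η * D.η = 1) (hχW : D.IsCS D.χW)
    (hiii : D.ηu = -1 → D.ηLine 0 = D.ηLine 1 → ∃ a c : D.Char, D.IsCS a ∧ D.IsCS c ∧
      D.eps a = D.ηLine 0 ∧ D.eps c = -D.ηLine 0 ∧ D.eps (c⁻¹ * a * a) = -D.ηLine 0) :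
    ∃ ξ : Fin 4 → D.Char, LocalSolution D ξ := by
  obtain ⟨ξa, hξa⟩ := signClass_nonempty D h35 hA1 hW hη hχW (D.ηLine 0)
  obtain ⟨ξb, hξb⟩ := signClass_nonempty D h35 hA1 hW hη hχW (D.ηLine 1)
  rcases Int.units_eq_one_or D.ηu with hu | hu
  · -- case (i): v ∉ S_g
    refine ⟨![ξa, ξb, ξa, ξb], ?_, hξa.2, hξb.2, ?_, ?_, ?_⟩
    · intro i
      fin_cases i <;> simp [hξa.1, hξb.1]
    · simp [hu, hξa.2]
    · simp [hu, hξb.2]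
    · simp
  · -- v ∈ S_g
    rcases Int.units_eq_one_or (D.ηLine 0 * D.ηLine 1) with h01 | h01
    · -- case (iii): s_a = s_b (the product of the two signs is 1)
      have h01' : D.ηLine 0 = D.ηLine 1 := by
        calc D.ηLine 0 = D.ηLine 0 * (D.ηLine 1 * D.ηLine 1) := by rw [Int.units_mul_self, mul_one]
          _ = (D.ηLine 0 * D.ηLine 1) * D.ηLine 1 := by rw [mul_assoc]
          _ = D.ηLine 1 := by rw [h01, one_mul]
      obtain ⟨a, c, ha, hc, has, hcs, hc'⟩ := hiii hu h01'
      exact localSolution_of_pair D hu h01' ha hc has hcs hc'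
    · -- case (ii): s_a = −s_b — the swap
      have hba : D.ηLine 1 = D.ηu * D.ηLine 0 := by
        rw [hu]
        calc D.ηLine 1 = (D.ηLine 0 * D.ηLine 0) * D.ηLine 1 := by rw [Int.units_mul_self, one_mul]
          _ = D.ηLine 0 * (D.ηLine 0 * D.ηLine 1) := by rw [mul_assoc]
          _ = D.ηLine 0 * (-1) := by rw [h01]
          _ = -1 * D.ηLine 0 := mul_comm _ _
      have hab : D.ηLine 0 = D.ηu * D.ηLine 1 := by
        rw [hba, ← mul_assoc, Int.units_mul_self, one_mul]
      refine ⟨![ξa, ξb, ξb, ξa], ?_, hξa.2, hξb.2, ?_, ?_, ?_⟩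
      · intro i
        fin_cases i <;> simp [hξa.1, hξb.1]
      · simp [hξb.2, hba]
      · simp [hξa.2, hab]
      · simp [mul_comm]

section Sides

variable {ι G : Type*} [CommGroup G]

/-- Side A of TIER5 §N5.5 (lines `a = 111`, `b = 100`) built from local sign data `D v` at the places `v : ι`
and local solutions `ξ v`: the sign fields are `omega v i := ω_{E_v/F_v}(λ_i)` and `eps v i := ε_v(ξ_i)`; the
remaining fields are those of a given side `X`. -/
def sideA (X : ToricSide ι G) (D : ι → LocalSignDatum) (ξ : ∀ v, Fin 4 → (D v).Char) : ToricSide ι G :=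
  { X with omega := fun v i => (D v).ηLine i, eps := fun v i => (D v).eps (ξ v (Fin.castLE (by decide) i)) }

/-- Side B of TIER5 §N5.5 (lines `c = 101`, `d = 110`: `ω_{E_v/F_v}(λ_c) = η_v(u)·ω(λ_a)`,
`ω(λ_d) = η_v(u)·ω(λ_b)`, TIER5 §N5.5(e)) built from the local data and solutions. -/
def sideB (X : ToricSide ι G) (D : ι → LocalSignDatum) (ξ : ∀ v, Fin 4 → (D v).Char) : ToricSide ι G :=
  { X with omega := fun v i => (D v).ηu * (D v).ηLine i, eps := fun v i => (D v).eps (ξ v (i.addNat 2)) }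

/-- Condition (b) of TIER5 §N5.5 for both sides, from local solutions of Theorem N5.T2 at every place of `ι`
(t6-p7's `ToricSide.condB`: `∀ v i, omega v i = eps v i`). -/
theorem condB_sides (XA XB : ToricSide ι G) (D : ι → LocalSignDatum) (ξ : ∀ v, Fin 4 → (D v).Char)
    (hξ : ∀ v, LocalSolution (D v) (ξ v)) :
    (sideA XA D ξ).condB ∧ (sideB XB D ξ).condB := by
  refine ⟨fun v i => ?_, fun v i => ?_⟩
  · obtain ⟨-, h0, h1, -, -, -⟩ := hξ v
    fin_cases i
    · exact h0.symm
    · exact h1.symm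
  · obtain ⟨-, -, -, h2, h3, -⟩ := hξ v
    fin_cases i
    · exact h2.symm
    · exact h3.symm

/-- The (S-H) identity at every place, packaged for the global assembly (TIER5 §N5.5(b): `ξ_c ξ_d = ξ_a ξ_b`). -/
theorem shiftHermitian_sides (D : ι → LocalSignDatum) (ξ : ∀ v, Fin 4 → (D v).Char)
    (hξ : ∀ v, LocalSolution (D v) (ξ v)) : ∀ v, ξ v 2 * ξ v 3 = ξ v 0 * ξ v 1 :=
  fun v => (hξ v).2.2.2.2.2

end Sides

end Summit.Ventures.HodgeRepro2.T6.N5Local
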